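import Literature.MathematicalPhysics.QuantumFieldTheory.Balaban1983to89.B15Ineq137Proof

/-!
# `Balaban1983to89.B15Ineq137Local` — T. Bałaban, *Large field renormalization. I. The basic step of the R operation*,
# Commun. Math. Phys. **122** (1989) 175–202 [Balaban1989LargeFieldI], (1.37) p. 184 WITH THE PRINTED LOCAL SUPREMUM
# *"|exp iℍ^{(j)}(b) − 1| ≤ O(1)L · sup_{B^j(b₋)∪B^j(b₊)} |ℍ|"*: the locality of [12]'s block averages (85) and of its gauge
# fixing at the block corners (87) in the small field, hence of the whole (1.36) quantity (`B15Ineq137Local`)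

statement-level skeleton of published theorems with citation tags; proofs where landed; nothing here is a claim
about the Yang–Mills mass gap

PDF held: `paper:balaban1989-cmp122-large-field-i` (journal page = PDF page + 174), p. 184 [PDF 10] READ AS AN IMAGE on
the x2 render `run/shared/lean/pub/pub-balaban/b2b-balaban-ref1/pages/1989-cmp122-large-field-I/…-p010-x2.png` (this
seat, 2026-08-21): the supremum in (1.37) is printed over `B^j(b₋) ∪ B^j(b₊)`.  [12] = T. Bałaban, *Averaging operations
for lattice gauge theories*, Commun. Math. Phys. **98** (1985) 17–51 [Balaban1985Averaging], (85)–(87) p. 31, (106)–(108)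
p. 33.

WHAT IS REPRODUCED.  SKELETON row **B15.Eq1.37** (rows of record `lit-balaban-r12/ROWS-B15.md`, head `proved p239014 +
p253704 + p254882`), mega-formalization `lit-balaban` (HOME `run/shared/lean/pub/lit-balaban/`), Phase-2 proof seat `p29`
gen 6 — an UPGRADE of this seat's `B15Ineq137Proof.ineq137_glev` (v1.1, p254882), which bounded the (1.36) quantity
`exp iℍ^{(j)}(b) = u_j(b₋)⁻¹·[M^j(e^{iξℍ}U₀)(b)M^j(U₀)(b)⁻¹]·R̄^j(u_j(b₊))` by `(136(d+1) + 320d)·sup|ℍ|` with a GLOBAL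
supremum for the gauge-fixing factors `u_j(b_±)` (declared deviation (M5′) there; the tilde factor was already localised,
`tilde_le_local`).  Here the supremum is the PRINTED one, over the two `j`-blocks `B^j(b₋) ∪ B^j(b₊)` of the bond `b`, for
all three factors.

THE ARGUMENT FORMALISED.  (i) LOCALITY OF [12] (85): the recursively defined block averages
`w_j(x_j) = \overline{R_{0,x_j}U₁^{(j)}}` (`B7Eq99Concrete.wrec`) depend on the small field `U₁` only through its bond variables
in the block `B^j(x_j)` (`wrec_congr`, induction on `j`: the site average (78) reads its function at the block points
(`B7Eq84Concrete.savg_congr`); the twisted transports (58) along the tree contours `Γ_{x_{j+1},x_j}` stay in the `L`-block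
(`B7Prop1Local.hol_treeWord_congr`); the averages `Ũ₁^j` (69) on its bonds are local by p. 24 of [12]
(`B7Prop1Local.avgIter_congr`); the block boxes nest, `box_mono_site`/`box_mono_bond`).  (ii) Hence THE GAUGE FIXING AT THE
BLOCK CORNERS, `u(Lʲq) = u_j(q) = (w_j(q))⁻¹` ((87) p. 31 of [12]: `B7Eq84Concrete.uLev_glev` + `glev_top`; `glev_corner`), depends
on `U₁` only through `B^j(q)` (`glev_corner_congr`); more generally (`glev_congr`, print's downward recursion (77)/(87) with the
block structure (2)/(3): `box_nest`, `fl_inBox`) the WHOLE gauge fixing `u = glev(U₀, U₁)` at level `k` restricted to a `k`-block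
`B^k(z)` — every level function `u_j` on the sites of `B^k(z)` — depends on `U₁` only through its bond variables in `B^k(z)`.  (iii) By (1.35)/(1.36) (`B15Ineq137Proof.avgIter_gaugeAct_ratio`) the
(1.36) quantity is `u(Lʲb₋)⁻¹·[M^j(e^{B}U₀)(b)M^j(U₀)(b)⁻¹]·M^j(U₀)(b)u(Lʲb₊)M^j(U₀)(b)⁻¹`; the middle factor depends on `B` only
through `B^j(b₋) ∪ B^j(b₊)` (p. 24 of [12], `avgIter_expCfg_mul_clamp`), the outer ones through `B^j(b₋)`, `B^j(b₊)` by (ii) — so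
the quantity is unchanged when `B` is replaced by `B∘π`, `π` the retraction onto the box `B^j(b₋) ∪ B^j(b₊)`
(`stdRep_congr_clamp`).  (iv) `B∘π` is bounded everywhere by the local supremum, and v1.1's global theorem
`B15Ineq137Proof.stdRep_dev_le` applies to it: `stdRep_dev_le_local`, and (1.37) verbatim `ineq137_local` —
`|exp iℍ^{(j)}(b) − 1| ≤ (136(d+1) + 320d)·sup_{B^j(b₋)∪B^j(b₊)}|ℍ|`, r12's leaf `Ineq137 dev (68 + 228d) L s_loc`.

MODEL / DECLARED DEVIATIONS (referee columns F6/F7).  (M1)–(M3′) exactly as in `B15Ineq137Proof` (the `B7Prop2Explicit`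
dictionary on `ℤ^d`; `U₀ = U_k^{(n+1)}` in Prop. 2's regime at level `j`; `u_j` = [12]'s gauge fixing `glev(U₀, e^{iξℍ})` of the
small field).  (M5′) of `B15Ineq137Proof` is REMOVED for (1.37): the supremum is over the sites of `B^j(b₋) ∪ B^j(b₊)` read as the
box `[Lʲq, Lʲq + (Lʲ − 1)𝟙 + Lʲe_κ]` of `B7Prop1Local` (`loK`/`bondHiK`; all bonds issuing from its sites — one layer more than
the bonds with both ends inside, so the printed statement under either reading of "sup over the blocks" follows).  Print's
`≤ O(1)L·sup` is met with `O(1)·L = (68 + 228d)·L ≥ 136(d+1) + 320d` for `L ≥ 2`.  Net new unproved facts: 0 (no `def`).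
-/

noncomputable section

open scoped BigOperators
open NormedSpace Finset

namespace Literature.MathematicalPhysics.QuantumFieldTheory.Balaban1983to89.B15Ineq137Local

open B7Prop1Explicit B7Prop2Explicit B7Prop3Flat B7Eq92Concrete B7Eq99Concrete B7Prop1Local
open B15.PrelimIntegrations (Ineq137)
open B15Ineq137Proof (stdRep_dev_le avgIter_gaugeAct_ratio avgIter_expCfg_mul_clamp norm_clamp_le)

-- `Site` alone could resolve to the torus sites of `Setup.lean` through a parent namespace; re-export the `ℤ^d`
-- sites of `B7Prop1Explicit`.
export B7Prop1Explicit (Site)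

variable {d : ℕ}

/-! ## §1 Nesting of the block boxes -/

/-- A site `y` of the `L`-block of `Lz` (level `n`): its `n`-block `[Lⁿy, Lⁿy + (Lⁿ − 1)𝟙]` of the original lattice lies in
the `(n+1)`-block `[Lⁿ⁺¹z, Lⁿ⁺¹z + (Lⁿ⁺¹ − 1)𝟙]` of `z` ((2)/(3) of [12]: blocks nest). [cite: Balaban1985Averaging, (2)–(3) p.17] -/
theorem box_mono_site {L : ℕ} (n : ℕ) {z y : Site d}
    (hy : InBox ((L : ℤ) • z) (fun i => (L : ℤ) * z i + ((L : ℤ) - 1)) y) (i : Fin d) :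
    loK L (n + 1) z i ≤ loK L n y i ∧
      loK L n y i + ((L : ℤ) ^ n - 1) ≤ loK L (n + 1) z i + ((L : ℤ) ^ (n + 1) - 1) := by
  have hP : (0 : ℤ) ≤ (L : ℤ) ^ n := by positivity
  have h1 := (hy i).1
  have h2 := (hy i).2
  simp only [Pi.smul_apply, smul_eq_mul] at h1 h2
  have h1' := mul_le_mul_of_nonneg_left h1 hP
  have h2' := mul_le_mul_of_nonneg_left h2 hP
  simp only [loK, pow_succ]
  constructor
  · nlinarith
  · nlinarith

/-- The same for the box `B^n(c₋) ∪ B^n(c₊)` of a bond `c = ⟨y, y + e_μ⟩` of level `n` with both ends in the `L`-block of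
`Lz`: it lies in the `(n+1)`-block of `z`. [cite: Balaban1985Averaging, (2)–(3) p.17, p.24 (sentence after (43))] -/
theorem box_mono_bond {L : ℕ} (n : ℕ) {z y : Site d} {μ : Fin d}
    (hy : InBox ((L : ℤ) • z) (fun i => (L : ℤ) * z i + ((L : ℤ) - 1)) y)
    (hyμ : InBox ((L : ℤ) • z) (fun i => (L : ℤ) * z i + ((L : ℤ) - 1)) (y + e μ)) (i : Fin d) :
    loK L (n + 1) z i ≤ loK L n y i ∧
      bondHiK L n y μ i ≤ loK L (n + 1) z i + ((L : ℤ) ^ (n + 1) - 1) := by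
  have hP : (0 : ℤ) ≤ (L : ℤ) ^ n := by positivity
  have h1 := (hy i).1
  have h2 := (hyμ i).2
  simp only [Pi.smul_apply, smul_eq_mul, add_e_apply] at h1 h2
  have h1' := mul_le_mul_of_nonneg_left h1 hP
  have h2' := mul_le_mul_of_nonneg_left h2 hP
  simp only [loK, bondHiK, pow_succ]
  constructor
  · nlinarith
  · split_ifs at h2' ⊢ <;> nlinarith

/-- The centre `Lz` and the block points `Lz + r`, `r ∈ [0, L)^d`, are sites of the `L`-block `[Lz, Lz + (L − 1)𝟙]`.
[cite: Balaban1985Averaging, (2) p.17] -/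
theorem inBox_block {L : ℕ} (hL : 1 ≤ L) (z : Site d) (r : Fin d → Fin L) :
    InBox ((L : ℤ) • z) (fun i => (L : ℤ) * z i + ((L : ℤ) - 1)) ((L : ℤ) • z) ∧
      InBox ((L : ℤ) • z) (fun i => (L : ℤ) * z i + ((L : ℤ) - 1)) ((L : ℤ) • z + boxVec L r) := by
  have hL' : (1 : ℤ) ≤ (L : ℤ) := by exact_mod_cast hL
  refine ⟨fun i => ?_, fun i => ?_⟩
  · simp only [Pi.smul_apply, smul_eq_mul]
    constructor <;> linarith
  · have := (r i).isLt
    simp only [Pi.add_apply, Pi.smul_apply, smul_eq_mul, boxVec]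
    constructor <;> omega

/-! ## §2 Locality of [12]'s block averages (85) and of the gauge fixing at the block corners (87) -/

section Averages

variable {𝔸 : Type*} [NormedRing 𝔸] [NormedAlgebra ℂ 𝔸] [CompleteSpace 𝔸]

/-- **Locality of `Ũ₁^j` (69)** on the bond `⟨y, y + e_μ⟩` of the `j`-th lattice, in the small field: two small fields `U₁`,
`U₁′` agreeing on the bonds of `B^j(y) ∪ B^j(y + e_μ)` (same background `U₀`) have the same `Ũ₁^j` there (p. 24 of [12]
for `(\overline{U₁U₀})^j`, `B7Prop1Local.avgIter_congr`). [cite: Balaban1985Averaging, (69) p.29, p.24 (sentence after (43))] -/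
theorem tildIter_congr {L : ℕ} (hL : 1 ≤ L) (U₀ : Site d → Fin d → 𝔸ˣ) (j : ℕ)
    {U₁ U₁' : Site d → Fin d → 𝔸ˣ} (y : Site d) (μ : Fin d)
    (h : AgreeOn (loK L j y) (bondHiK L j y μ) U₁ U₁') :
    tildIter L U₀ U₁ j y μ = tildIter L U₀ U₁' j y μ := by
  rw [tildIter_apply, tildIter_apply,
    avgIter_congr L hL j y μ (V := U₁ * U₀) (V' := U₁' * U₀) fun x κ hx hx' => by
      simp only [Pi.mul_apply, h x κ hx hx']]

/-- **LOCALITY OF THE BLOCK AVERAGES (85) of [12]** — *"\overline{R_{0,x_{j+1}}U₁^{(j+1)}} = {(R̄^j_{0,x_{j+1}}Ũ₁^j)(Γ_{x_{j+1},x_j})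
(R̄^j_{0,x_{j+1}}\overline{R_{0,x_j}U₁^{(j)}})(x_j)}_{x_j∈B(x_{j+1})}"*: `w_j(z) = \overline{R_{0,z}U₁^{(j)}}` (`B7Eq99Concrete.wrec`) depends on
the small field `U₁` only through its bond variables in the block `B^j(z) = [Lʲz, Lʲz + (Lʲ − 1)𝟙]` of the original lattice
(background `U₀` fixed).  Induction on `j`: the site average (78) reads its function at the block points `x_j ∈ B(x_{j+1})`
(`savg_congr`), where the contour `Γ_{x_{j+1},x_j}` stays in the `L`-block (`hol_treeWord_congr`), `Ũ₁^j` on its bonds is local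
(`tildIter_congr`), and the previous average at `x_j` is local by induction; the boxes nest (§1).
[cite: Balaban1985Averaging, (85) p.31, (78) p.30, p.24 (sentence after (43))] -/
theorem wrec_congr {L : ℕ} (hL : 1 ≤ L) (U₀ : Site d → Fin d → 𝔸ˣ) :
    ∀ (j : ℕ) {U₁ U₁' : Site d → Fin d → 𝔸ˣ} (z : Site d),
      AgreeOn (loK L j z) (fun i => loK L j z i + ((L : ℤ) ^ j - 1)) U₁ U₁' →
        wrec L U₀ U₁ j z = wrec L U₀ U₁' j z
  | 0, U₁, U₁', z, _ => by simp
  | j + 1, U₁, U₁', z, h => by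
    rw [wrec_succ, wrec_succ]
    -- the averaged function agrees on the whole `L`-block of `Lz`
    have hblock : ∀ x, InBox ((L : ℤ) • z) (fun i => (L : ℤ) * z i + ((L : ℤ) - 1)) x →
        tHol (avgIter L U₀ j) (tildIter L U₀ U₁ j) ((L : ℤ) • z) (treeWord (x - (L : ℤ) • z))
            * R0fun (avgIter L U₀ j) ((L : ℤ) • z) (wrec L U₀ U₁ j) x
          = tHol (avgIter L U₀ j) (tildIter L U₀ U₁' j) ((L : ℤ) • z) (treeWord (x - (L : ℤ) • z))
            * R0fun (avgIter L U₀ j) ((L : ℤ) • z) (wrec L U₀ U₁' j) x := by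
      intro x hx
      -- `Ũ₁^j·Ū₀^j` agrees on the bonds of the `L`-block
      have hT : AgreeOn ((L : ℤ) • z) (fun i => (L : ℤ) * z i + ((L : ℤ) - 1))
          (tildIter L U₀ U₁ j * avgIter L U₀ j) (tildIter L U₀ U₁' j * avgIter L U₀ j) := by
        intro y μ hy hyμ
        simp only [Pi.mul_apply]
        rw [tildIter_congr hL U₀ j y μ (h.mono (fun i => (box_mono_bond j hy hyμ i).1)
          (fun i => (box_mono_bond j hy hyμ i).2))]
      have hx' : InBox ((L : ℤ) • z) (fun i => (L : ℤ) * z i + ((L : ℤ) - 1)) ((L : ℤ) • z + (x - (L : ℤ) • z)) := by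
        convert hx using 2; abel
      have h1 : tHol (avgIter L U₀ j) (tildIter L U₀ U₁ j) ((L : ℤ) • z) (treeWord (x - (L : ℤ) • z))
          = tHol (avgIter L U₀ j) (tildIter L U₀ U₁' j) ((L : ℤ) • z) (treeWord (x - (L : ℤ) • z)) := by
        unfold tHol
        rw [hol_treeWord_congr hT ((L : ℤ) • z) (x - (L : ℤ) • z) (inBox_block hL z (fun _ => ⟨0, hL⟩)).1 hx']
      have h2 : wrec L U₀ U₁ j x = wrec L U₀ U₁' j x :=
        wrec_congr hL U₀ j x (h.mono (fun i => (box_mono_site j hx i).1) (fun i => (box_mono_site j hx i).2))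
      rw [h1, R0fun_apply, R0fun_apply, h2]
    exact B7Eq84Concrete.savg_congr L (hblock _ (inBox_block hL z (fun _ => ⟨0, hL⟩)).1)
      fun r => hblock _ (inBox_block hL z r).2

/-- **The gauge fixing at the block corners is (87)**: for `u := glev(U₀, U₁)` at level `j` ([12] p. 31: *"the gauge
transformation is uniquely determined by all the conditions and is given by the formulas (77) for j = k − 1 and by (87)"*),
`u(Lʲq) = u_j(q) = (\overline{R_{0,q}U₁^{(j)}})⁻¹ = (w_j(q))⁻¹`. [cite: Balaban1985Averaging, (87) p.31] -/
theorem glev_corner {L : ℕ} (hL : 1 ≤ L) (U₀ U₁ : Site d → Fin d → 𝔸ˣ) (j : ℕ) (q : Site d) :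
    B7Eq84Concrete.glev L hL U₀ U₁ j 0 (((L : ℤ) ^ j) • q) = (wrec L U₀ U₁ j q)⁻¹ := by
  have h := congrFun (B7Eq84Concrete.uLev_glev L hL U₀ U₁ j j le_rfl) q
  rw [B7AvgGaugeCovariance.uLev_apply] at h
  rw [h, B7Eq84Concrete.glev_top]

/-- **LOCALITY OF THE GAUGE FIXING AT THE BLOCK CORNERS**: `u(Lʲq)`, `u = glev(U₀, U₁)` at level `j`, depends on the small
field `U₁` only through its bond variables in the block `B^j(q)` ((87) + the locality of (85)). This is what makes the
factors `u_j(b_±)` of (1.36) local in `B^j(b₋)`, `B^j(b₊)` ((106)–(108) of [12] as cited on p. 184).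
[cite: Balaban1985Averaging, (87) p.31, (85) p.31] -/
theorem glev_corner_congr {L : ℕ} (hL : 1 ≤ L) (U₀ : Site d → Fin d → 𝔸ˣ) (j : ℕ)
    {U₁ U₁' : Site d → Fin d → 𝔸ˣ} (q : Site d)
    (h : AgreeOn (loK L j q) (fun i => loK L j q i + ((L : ℤ) ^ j - 1)) U₁ U₁') :
    B7Eq84Concrete.glev L hL U₀ U₁ j 0 (((L : ℤ) ^ j) • q)
      = B7Eq84Concrete.glev L hL U₀ U₁' j 0 (((L : ℤ) ^ j) • q) := by
  rw [glev_corner, glev_corner, wrec_congr hL U₀ j q h]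

/-- Blocks nest across `m` levels: a site `w` of the `m`-block `[Lᵐz, Lᵐz + (Lᵐ − 1)𝟙]` of `z` has its `n`-block inside
the `(n+m)`-block of `z` ((2)/(3) of [12]). [cite: Balaban1985Averaging, (2)–(3) p.17] -/
theorem box_nest {L : ℕ} (n m : ℕ) {z w : Site d}
    (hw : InBox (loK L m z) (fun i => loK L m z i + ((L : ℤ) ^ m - 1)) w) (i : Fin d) :
    loK L (n + m) z i ≤ loK L n w i ∧
      loK L n w i + ((L : ℤ) ^ n - 1) ≤ loK L (n + m) z i + ((L : ℤ) ^ (n + m) - 1) := by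
  have hP : (0 : ℤ) ≤ (L : ℤ) ^ n := by positivity
  have h1 := (hw i).1
  have h2 := (hw i).2
  simp only [loK] at h1 h2
  have h1' := mul_le_mul_of_nonneg_left h1 hP
  have h2' := mul_le_mul_of_nonneg_left h2 hP
  simp only [loK, pow_add]
  constructor
  · linarith
  · linarith

/-- The coarse site `x_{j+1}` below a site `x_j` of the `(m+1)`-block of `z` (`B8Ineq130.fl`: coordinatewise Euclidean
quotient by `L`, the block structure (2)/(3) of [12]) lies in the `m`-block of `z`. [cite: Balaban1985Averaging, (2)–(3) p.17] -/
theorem fl_inBox {L : ℕ} (hL : 1 ≤ L) (m : ℕ) {z x : Site d}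
    (hx : InBox (loK L (m + 1) z) (fun i => loK L (m + 1) z i + ((L : ℤ) ^ (m + 1) - 1)) x) :
    InBox (loK L m z) (fun i => loK L m z i + ((L : ℤ) ^ m - 1)) (B8Ineq130.fl L x) := by
  have hL0 : (0 : ℤ) < (L : ℤ) := by exact_mod_cast hL
  intro i
  have h1 := (hx i).1
  have h2 := (hx i).2
  simp only [loK, pow_succ] at h1 h2
  simp only [loK, B8Ineq130.fl]
  constructor
  · exact Int.le_ediv_of_mul_le hL0 (by linarith)
  · have h3 : x i < ((L : ℤ) ^ m * z i + (L : ℤ) ^ m) * (L : ℤ) := by linarith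
    have h4 := Int.lt_iff_add_one_le.mp (Int.ediv_lt_of_lt_mul hL0 h3)
    linarith

/-- **LOCALITY OF THE GAUGE FIXING of [12]** (p. 31: *"the gauge transformation is uniquely determined by all the conditions
and is given by the formulas (77) for j = k − 1 and by (87)"*), `u = glev(U₀, U₁)` at level `k`: for every `m ≤ k` and every
site `x_j`, `j = k − m`, of the `m`-block of a site `z` of the `k`-th lattice, the level-`j` function `u_j(x_j)` depends on
the small field `U₁` only through its bond variables in the block `B^k(z) = [Lᵏz, Lᵏz + (Lᵏ − 1)𝟙]` of the original lattice
(background `U₀` fixed) — in particular (`m = k`) the gauge transformation `u` itself on `B^k(z)`.  Downward induction as in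
print: (87) on `Ω^{(k)}` is local by `wrec_congr`; (76)/(77) transports from the block centre `x_{j+1}` along `Γ_{x_{j+1},x_j}`
inside the `L`-block, where `Ũ₁^j` is local (`tildIter_congr`), the boxes nesting (§1).
[cite: Balaban1985Averaging, (76)–(77) p.29–30, (87) p.31] -/
theorem glev_congr {L : ℕ} (hL : 1 ≤ L) (U₀ : Site d → Fin d → 𝔸ˣ) {U₁ U₁' : Site d → Fin d → 𝔸ˣ} (z : Site d)
    (k : ℕ) (hag : AgreeOn (loK L k z) (fun i => loK L k z i + ((L : ℤ) ^ k - 1)) U₁ U₁') :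
    ∀ (m j : ℕ) (x : Site d), j + m = k →
      InBox (loK L m z) (fun i => loK L m z i + ((L : ℤ) ^ m - 1)) x →
        B7Eq84Concrete.glev L hL U₀ U₁ k j x = B7Eq84Concrete.glev L hL U₀ U₁' k j x
  | 0, j, x, hjk, hx => by
    have hxz : x = z := funext fun i => by
      have h := hx i
      simp only [loK, pow_zero, one_mul, sub_self, add_zero] at h
      exact le_antisymm h.2 h.1
    subst hxz
    have hj : j = k := by omega
    subst hj
    rw [B7Eq84Concrete.glev_top, B7Eq84Concrete.glev_top, wrec_congr hL U₀ j x hag]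
  | m + 1, j, x, hjk, hx => by
    have hj : j < k := by omega
    rw [B7Eq84Concrete.glev_of_lt L hL U₀ U₁ hj, B7Eq84Concrete.glev_of_lt L hL U₀ U₁' hj]
    have hfl := fl_inBox hL m hx
    have IH := glev_congr hL U₀ z k hag m (j + 1) (B8Ineq130.fl L x) (by omega) hfl
    -- `Ũ₁^j·Ū₀^j` agrees on the bonds of the `L`-block of `L·x_{j+1}`
    have hT : AgreeOn ((L : ℤ) • B8Ineq130.fl L x) (fun i => (L : ℤ) * B8Ineq130.fl L x i + ((L : ℤ) - 1))
        (tildIter L U₀ U₁ j * avgIter L U₀ j) (tildIter L U₀ U₁' j * avgIter L U₀ j) := by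
      intro y μ hy hyμ
      simp only [Pi.mul_apply]
      obtain rfl : k = j + 1 + m := by omega
      rw [tildIter_congr hL U₀ j y μ (hag.mono
        (fun i => ((box_nest (j + 1) m hfl i).1).trans (box_mono_bond j hy hyμ i).1)
        (fun i => ((box_mono_bond j hy hyμ i).2).trans (box_nest (j + 1) m hfl i).2))]
    rw [IH]
    unfold tHol
    rw [hol_treeWord_congr hT ((L : ℤ) • B8Ineq130.fl L x) (boxVec L (B7Eq84Concrete.brem L hL x))
      (inBox_block hL _ (fun _ => ⟨0, hL⟩)).1 (inBox_block hL _ _).2]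

end Averages

/-! ## §3 (1.37) with the printed supremum over `B^j(b₋) ∪ B^j(b₊)` -/

section Local137

variable {𝔸 : Type*} [NormedRing 𝔸] [NormedAlgebra ℂ 𝔸] [CompleteSpace 𝔸] [NormOneClass 𝔸]

omit [NormOneClass 𝔸] in
/-- **The (1.36) quantity depends on the exponent field only through `B^j(b₋) ∪ B^j(b₊)`**: for `b = ⟨q, q + e_κ⟩`,
`u := glev(U₀, e^{B})` at level `j`, the quantity `M^j((e^{B}U₀)^{u⁻¹})(b)·M^j(U₀)(b)⁻¹ = u(Lʲb₋)⁻¹[M^j(e^{B}U₀)(b)M^j(U₀)(b)⁻¹]R̄^j(u(Lʲb₊))`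
((1.35)/(1.36)) is unchanged when `B` is replaced by `B∘π`, `π` the retraction onto the box `B^j(b₋) ∪ B^j(b₊)`: the middle
factor by p. 24 of [12], the gauge-fixing factors by §2. [cite: Balaban1989LargeFieldI, (1.35)–(1.37) p.184] -/
theorem stdRep_congr_clamp {L : ℕ} (hL1 : 1 ≤ L) (U₀ : Site d → Fin d → 𝔸ˣ) (j : ℕ) (B : Site d → Fin d → 𝔸)
    (q : Site d) (κ : Fin d) :
    ((avgIter L (gaugeAct (B7Eq84Concrete.glev L hL1 U₀ (expCfg B) j 0)⁻¹ (expCfg B * U₀)) j q κ : 𝔸ˣ) : 𝔸)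
        * (((avgIter L U₀ j q κ)⁻¹ : 𝔸ˣ) : 𝔸)
      = ((avgIter L (gaugeAct (B7Eq84Concrete.glev L hL1 U₀
            (expCfg (fun x μ => B (clamp (loK L j q) (bondHiK L j q κ) x) μ)) j 0)⁻¹
            (expCfg (fun x μ => B (clamp (loK L j q) (bondHiK L j q κ) x) μ) * U₀)) j q κ : 𝔸ˣ) : 𝔸)
        * (((avgIter L U₀ j q κ)⁻¹ : 𝔸ˣ) : 𝔸) := by
  -- the two small fields agree on the bonds issuing from the box
  have hagree : AgreeOn (loK L j q) (bondHiK L j q κ) (expCfg B)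
      (expCfg (fun x μ => B (clamp (loK L j q) (bondHiK L j q κ) x) μ)) := fun x μ hx _ => by
    simp only [expCfg, clamp_of_inBox hx]
  have hP : (0 : ℤ) ≤ (L : ℤ) ^ j := by positivity
  -- the gauge fixing at the two block corners `Lʲq`, `Lʲ(q + e_κ)`
  have h₁ := glev_corner_congr hL1 U₀ j q (hagree.mono (fun i => le_rfl) (fun i => by
      simp only [loK, bondHiK]; split_ifs <;> linarith))
  have h₂ := glev_corner_congr hL1 U₀ j (q + e κ) (hagree.mono
      (fun i => by simp only [loK, add_e_apply]; split_ifs <;> nlinarith)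
      (fun i => by simp only [loK, bondHiK, add_e_apply]; split_ifs <;> nlinarith))
  rw [avgIter_gaugeAct_ratio, avgIter_gaugeAct_ratio, Pi.inv_apply, Pi.inv_apply, Pi.inv_apply, Pi.inv_apply,
    h₁, h₂, avgIter_expCfg_mul_clamp hL1 j U₀ B q κ]

/-- **THE STANDARD-REPRESENTATION DEVIATION WITH A LOCAL BOUND.**  As `B15Ineq137Proof.stdRep_dev_le` (regime (M2) for
`U₀` at level `j`; `u := glev(U₀, e^{B})`), but with the exponent field bounded by `b` ONLY on the bonds issuing from the box
`B^j(b₋) ∪ B^j(b₊)` of `b = ⟨q, q + e_κ⟩` (`x := Lʲb` under the four smallness conditions of `eq164_general`):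
`|M^j((e^{B}U₀)^{u⁻¹})(b)·M^j(U₀)(b)⁻¹ − 1| ≤ (136(d+1) + 320d)·Lʲb` — by `stdRep_congr_clamp` and the global theorem applied
to the clamped field. [cite: Balaban1989LargeFieldI, (1.34)–(1.37) p.184] -/
theorem stdRep_dev_le_local {L : ℕ} (hL : 2 ≤ L) {G : Subgroup 𝔸ˣ} (hG : AvgClosed d L G) {j : ℕ}
    {U₀ : Site d → Fin d → 𝔸ˣ} (hU₀ : ∀ x κ, U₀ x κ ∈ G) {α₀ : ℝ} (hα : 0 < α₀) (hα3 : C0 d * α₀ ≤ 1 / 3)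
    (hα4 : 4 * α₀ ≤ c2' d L) (h52 : pdev U₀ < α₀ * (((L : ℝ) ^ j)⁻¹) ^ 2)
    (B : Site d → Fin d → 𝔸) (q : Site d) (κ : Fin d) {b : ℝ} (hb : 0 ≤ b)
    (hB : ∀ y μ, InBox (loK L j q) (bondHiK L j q κ) y → ‖B y μ‖ ≤ b)
    (hsmall : Real.exp (4 * (800 * ((d : ℝ) + 1) ^ 2 * ((d : ℝ) + 4)) * α₀)
      * (1 + 8 * (131072 * ((d : ℝ) + 1) ^ 2) * ((L : ℝ) ^ j * b)) ≤ 2)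
    (hc₃ : 2 * ((L : ℝ) ^ j * b) ≤ c3 d L) (hsm : 2048 * (d : ℝ) * ((L : ℝ) ^ j * b) ≤ 1)
    (h1 : 128 * ((L : ℝ) ^ j * b) ≤ 1) (hL1 : 1 ≤ L) :
    ‖((avgIter L (gaugeAct (B7Eq84Concrete.glev L hL1 U₀ (expCfg B) j 0)⁻¹ (expCfg B * U₀)) j q κ : 𝔸ˣ) : 𝔸)
        * (((avgIter L U₀ j q κ)⁻¹ : 𝔸ˣ) : 𝔸) - 1‖ ≤ (136 * ((d : ℝ) + 1) + 320 * d) * ((L : ℝ) ^ j * b) := by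
  rw [stdRep_congr_clamp hL1 U₀ j B q κ]
  exact stdRep_dev_le hL hG hU₀ hα hα3 hα4 h52 _ q κ hb (norm_clamp_le hL1 hB) hsmall hc₃ hsm h1 hL1

/-- **(1.37) AS PRINTED, LOCAL SUPREMUM** — *"From the equalities and bounds (106)–(108), (159)–(163) in [12] we obtain
|exp iℍ^{(j)}(b) − 1| ≤ O(1)L · sup_{B^j(b₋)∪B^j(b₊)} |ℍ|. (1.37)"*: regime (M2) for `U₀ = U_k^{(n+1)}` at level `j`, `ξ = L^{−j}`,
`B = iξℍ`, `u := glev(U₀, e^{iξℍ})` ([12]'s gauge fixing, READING (M3′)), and `s ≥ |ℍ(y)|` for the sites `y` of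
`B^j(b₋) ∪ B^j(b₊)` only (`b = ⟨q, q + e_κ⟩`; the box `[Lʲq, Lʲq + (Lʲ − 1)𝟙 + Lʲe_κ]`), under the four smallness conditions
for `s`: `|exp iℍ^{(j)}(b) − 1| ≤ (136(d+1) + 320d)·s`, hence r12's leaf `Ineq137 dev (68 + 228d) L s` (`L ≥ 2`).
[cite: Balaban1989LargeFieldI, (1.35)–(1.37) p.184] -/
theorem ineq137_local {L : ℕ} (hL : 2 ≤ L) {G : Subgroup 𝔸ˣ} (hG : AvgClosed d L G) {j : ℕ}
    {U₀ : Site d → Fin d → 𝔸ˣ} (hU₀ : ∀ x κ, U₀ x κ ∈ G) {α₀ : ℝ} (hα : 0 < α₀) (hα3 : C0 d * α₀ ≤ 1 / 3)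
    (hα4 : 4 * α₀ ≤ c2' d L) (h52 : pdev U₀ < α₀ * (((L : ℝ) ^ j)⁻¹) ^ 2)
    (H : Site d → Fin d → 𝔸) (q : Site d) (κ : Fin d) {s : ℝ} (hs : 0 ≤ s)
    (hH : ∀ y μ, InBox (loK L j q) (bondHiK L j q κ) y → ‖H y μ‖ ≤ s)
    (hsmall : Real.exp (4 * (800 * ((d : ℝ) + 1) ^ 2 * ((d : ℝ) + 4)) * α₀)
      * (1 + 8 * (131072 * ((d : ℝ) + 1) ^ 2) * s) ≤ 2)
    (hc₃ : 2 * s ≤ c3 d L) (hsm : 2048 * (d : ℝ) * s ≤ 1) (h1 : 128 * s ≤ 1) (hL1 : 1 ≤ L) :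
    ‖((avgIter L
          (gaugeAct (B7Eq84Concrete.glev L hL1 U₀
              (expCfg (fun y μ => ((Complex.I : ℂ) * ((((L : ℝ) ^ j)⁻¹ : ℝ) : ℂ)) • H y μ)) j 0)⁻¹
            (expCfg (fun y μ => ((Complex.I : ℂ) * ((((L : ℝ) ^ j)⁻¹ : ℝ) : ℂ)) • H y μ) * U₀)) j q κ : 𝔸ˣ) : 𝔸)
        * (((avgIter L U₀ j q κ)⁻¹ : 𝔸ˣ) : 𝔸) - 1‖ ≤ (136 * ((d : ℝ) + 1) + 320 * d) * s ∧
    Ineq137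
      ‖((avgIter L
          (gaugeAct (B7Eq84Concrete.glev L hL1 U₀
              (expCfg (fun y μ => ((Complex.I : ℂ) * ((((L : ℝ) ^ j)⁻¹ : ℝ) : ℂ)) • H y μ)) j 0)⁻¹
            (expCfg (fun y μ => ((Complex.I : ℂ) * ((((L : ℝ) ^ j)⁻¹ : ℝ) : ℂ)) • H y μ) * U₀)) j q κ : 𝔸ˣ) : 𝔸)
        * (((avgIter L U₀ j q κ)⁻¹ : 𝔸ˣ) : 𝔸) - 1‖
      (68 + 228 * (d : ℝ)) L s := by
  have hLr : (2 : ℝ) ≤ L := by exact_mod_cast hL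
  have hLj : (0 : ℝ) < (L : ℝ) ^ j := by positivity
  have hd : (0 : ℝ) ≤ d := Nat.cast_nonneg d
  set ξ : ℝ := ((L : ℝ) ^ j)⁻¹ with hξ
  have hξ0 : 0 ≤ ξ := inv_nonneg.mpr hLj.le
  -- the exponent field `B = iξℍ` is bounded by `ξs` on the box, and `Lʲ·(ξs) = s`
  have hB : ∀ y μ, InBox (loK L j q) (bondHiK L j q κ) y →
      ‖((Complex.I : ℂ) * ((ξ : ℝ) : ℂ)) • H y μ‖ ≤ ξ * s := fun y μ hy => by
    rw [norm_smul, norm_mul, Complex.norm_I, one_mul, Complex.norm_real, Real.norm_of_nonneg hξ0]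
    exact mul_le_mul_of_nonneg_left (hH y μ hy) hξ0
  have hx : (L : ℝ) ^ j * (ξ * s) = s := by
    rw [hξ, ← mul_assoc, mul_inv_cancel₀ hLj.ne', one_mul]
  have h := stdRep_dev_le_local hL hG hU₀ hα hα3 hα4 h52
    (fun y μ => ((Complex.I : ℂ) * ((ξ : ℝ) : ℂ)) • H y μ) q κ (mul_nonneg hξ0 hs) hB
    (by rw [hx]; exact hsmall) (by rw [hx]; exact hc₃) (by rw [hx]; exact hsm) (by rw [hx]; exact h1) hL1
  rw [hx] at h
  refine ⟨h, ?_⟩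
  unfold Ineq137
  refine h.trans ?_
  have h0 : (0 : ℝ) ≤ (136 * ((d : ℝ) + 1) + 320 * d) * s := by positivity
  nlinarith

end Local137

end Literature.MathematicalPhysics.QuantumFieldTheory.Balaban1983to89.B15Ineq137Local

end
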